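import Summits.Ventures.PercRepro.RankLevelSetCountBounds

/-!
# PercRepro — the `j`-subsets CONFINED to a set `S` up to `b₀` points (p8 g12, S3):
`#{W ⊆ E : |W| = j, |W ∖ S| ≤ b₀} ≤ Σ_{b ≤ b₀} C(|E| − |S|, b)·C(|S|, j − b)`

The counting half of THE CONFINEMENT LEMMA's form (ii) (RankLevelSetConfinement.lean, `proofs/P8-G12-LEVER22.md` §3):
with `S` = the union of the triangles, `ν(S) ≥ cq3⁻¹(s₃)` and `|S| ≤ 3ν(S)`, every `B ∈ U` has `|B ∖ S| ≤ d − ν(S)`, and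
the `j`-sets with at most `b₀` points outside `S` are counted by `W ↦ (W ∖ S, W ∩ S)` into the products of the `b`-subsets of
`E ∖ S` and the `(j − b)`-subsets of `S`. On night-1's `ncard_subsets_ncard_eq`. Axioms: standard.
-/

namespace PercRepro

open Finset Set

variable {α : Type*}

/-- The `j`-subsets `W` of `E` with `|W ∖ S| = b` exactly inject into (the `b`-subsets of `E ∖ S`) × (the
`(j − b)`-subsets of `S`): at most `C(|E| − |S|, b)·C(|S|, j − b)` of them. -/
theorem ncard_subsets_outside_eq_le (E : Finset α) (S : Set α) (hS : S ⊆ (E : Set α)) (j b : ℕ) :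
    {W : Set α | W ⊆ (E : Set α) ∧ W.ncard = j ∧ (W \ S).ncard = b}.ncard ≤
      (E.card - S.ncard).choose b * S.ncard.choose (j - b) := by
  classical
  have hSfin : S.Finite := E.finite_toSet.subset hS
  -- the two target families
  set T1 := {X : Set α | X ⊆ ((E : Set α) \ S) ∧ X.ncard = b} with hT1
  set T2 := {Y : Set α | Y ⊆ S ∧ Y.ncard = j - b} with hT2
  have hT1c : T1.ncard = (E.card - S.ncard).choose b := by
    have hcoe : (((E.filter (fun x => x ∉ S)) : Finset α) : Set α) = (E : Set α) \ S := by
      ext x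
      simp only [Finset.coe_filter, Set.mem_setOf_eq, Set.mem_sdiff, Finset.mem_coe]
    have hcard : (E.filter (fun x => x ∉ S)).card = E.card - S.ncard := by
      have h1 := Finset.card_filter_add_card_filter_not (s := E) (fun x => x ∈ S)
      have h2 : (E.filter (fun x => x ∈ S)).card = S.ncard := by
        have hset : (((E.filter (fun x => x ∈ S)) : Finset α) : Set α) = S := by
          ext x
          simp only [Finset.coe_filter, Set.mem_setOf_eq]
          exact ⟨fun h => h.2, fun hx => ⟨hS hx, hx⟩⟩
        rw [← Set.ncard_coe_finset, hset]
      omega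
    rw [hT1, ← hcoe, ncard_subsets_ncard_eq, hcard]
  have hT2c : T2.ncard = S.ncard.choose (j - b) := by
    have hcoe : ((hSfin.toFinset : Finset α) : Set α) = S := hSfin.coe_toFinset
    rw [hT2, ← hcoe, ncard_subsets_ncard_eq, Set.ncard_coe_finset]
  have hT1fin : T1.Finite := (E.finite_toSet.sdiff).finite_subsets.subset (fun X hX => hX.1)
  have hT2fin : T2.Finite := hSfin.finite_subsets.subset (fun Y hY => hY.1)
  have hmaps : ∀ W ∈ {W : Set α | W ⊆ (E : Set α) ∧ W.ncard = j ∧ (W \ S).ncard = b},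
      (fun W : Set α => (W \ S, W ∩ S)) W ∈ T1 ×ˢ T2 := by
    rintro W ⟨hWE, hWj, hWb⟩
    have hWfin : W.Finite := E.finite_toSet.subset hWE
    refine Set.mem_prod.2 ⟨⟨fun x hx => ⟨hWE hx.1, hx.2⟩, hWb⟩, ⟨Set.inter_subset_right, ?_⟩⟩
    show (W ∩ S).ncard = j - b
    have h := Set.ncard_inter_add_ncard_sdiff_eq_ncard W S hWfin
    omega
  have hinj : Set.InjOn (fun W : Set α => (W \ S, W ∩ S))
      {W : Set α | W ⊆ (E : Set α) ∧ W.ncard = j ∧ (W \ S).ncard = b} := by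
    intro W _ W' _ h
    simp only [Prod.mk.injEq] at h
    rw [← Set.sdiff_union_inter W S, ← Set.sdiff_union_inter W' S, h.1, h.2]
  calc {W : Set α | W ⊆ (E : Set α) ∧ W.ncard = j ∧ (W \ S).ncard = b}.ncard
      ≤ (T1 ×ˢ T2).ncard := Set.ncard_le_ncard_of_injOn _ hmaps hinj (hT1fin.prod hT2fin)
    _ = T1.ncard * T2.ncard := Set.ncard_prod
    _ = (E.card - S.ncard).choose b * S.ncard.choose (j - b) := by rw [hT1c, hT2c]

/-- **The confined subsets**: the `j`-subsets `W` of `E` with at most `b₀` points outside `S` number at most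
`Σ_{b ≤ b₀} C(|E| − |S|, b)·C(|S|, j − b)`. -/
theorem ncard_subsets_confined_le (E : Finset α) (S : Set α) (hS : S ⊆ (E : Set α)) (j b₀ : ℕ) :
    {W : Set α | W ⊆ (E : Set α) ∧ W.ncard = j ∧ (W \ S).ncard ≤ b₀}.ncard ≤
      ∑ b ∈ Finset.range (b₀ + 1), (E.card - S.ncard).choose b * S.ncard.choose (j - b) := by
  classical
  have hsub : {W : Set α | W ⊆ (E : Set α) ∧ W.ncard = j ∧ (W \ S).ncard ≤ b₀} ⊆
      ⋃ b ∈ Finset.range (b₀ + 1), {W : Set α | W ⊆ (E : Set α) ∧ W.ncard = j ∧ (W \ S).ncard = b} := by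
    rintro W ⟨hWE, hWj, hWb⟩
    simp only [Set.mem_iUnion, Set.mem_setOf_eq, Finset.mem_range, exists_prop]
    exact ⟨(W \ S).ncard, Nat.lt_succ_of_le hWb, hWE, hWj, rfl⟩
  have hfin : ∀ b, {W : Set α | W ⊆ (E : Set α) ∧ W.ncard = j ∧ (W \ S).ncard = b}.Finite :=
    fun b => E.finite_toSet.finite_subsets.subset (fun W hW => hW.1)
  calc {W : Set α | W ⊆ (E : Set α) ∧ W.ncard = j ∧ (W \ S).ncard ≤ b₀}.ncard
      ≤ (⋃ b ∈ Finset.range (b₀ + 1),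
          {W : Set α | W ⊆ (E : Set α) ∧ W.ncard = j ∧ (W \ S).ncard = b}).ncard :=
        Set.ncard_le_ncard hsub (Set.Finite.biUnion (Finset.range (b₀ + 1)).finite_toSet (fun b _ => hfin b))
    _ ≤ ∑ b ∈ Finset.range (b₀ + 1),
          {W : Set α | W ⊆ (E : Set α) ∧ W.ncard = j ∧ (W \ S).ncard = b}.ncard :=
        Finset.set_ncard_biUnion_le _ _
    _ ≤ ∑ b ∈ Finset.range (b₀ + 1), (E.card - S.ncard).choose b * S.ncard.choose (j - b) :=
        Finset.sum_le_sum (fun b _ => ncard_subsets_outside_eq_le E S hS j b)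

end PercRepro
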